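import Summits.QuantumFields.YangMills.Theorems.LangevinControlUVFemtoCurvatureTwoPointStrictRPOddTransfer
import Summits.QuantumFields.YangMills.Theorems.LangevinControlUVFemtoCurvatureTwoPointStrictRPGramZero
import Summits.QuantumFields.YangMills.Theorems.LangevinControlUVFemtoCurvatureTwoPointStrictRPSiteTransferForm
import Literature.MathematicalPhysics.QuantumFieldTheory.FlatLatticeGaugeFields

/-!
# Crux `FemtoCurvatureTwoPoint` (stmt-QuantumFields-9363, route `LangevinControlUV`):
# strict positivity of the axis covariance — odd torus: transfer form and reflection form with equality

Helper for the registered sub-goal `stub_axisPositive` (`--supports stmt-QuantumFields-9363`), odd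
torus. (1) **Transfer form** (`chiOddR_eq_integral_sliceKernel`): for a spatial plaquette `q` in the
middle slice, `χ_ℝ(V) = ∫ (Re tr ρ(W_q) − m) · exp(β rest(splice(V, W))) · K_{E_mid}(shiftUp V, W) dW`
(resample the top temporal links, flip the kernel, Fubini, gauge invariance of Haar measure and
plaquette traces). (2) **Odd reflection positivity with equality** (`integral_oddChi_normSq_eq_zero`):
if the reflection form `∫ e^{-βS} conj F(ΘU) F(U) dU` of the mixed reflection vanishes, then the
crossing-free slab functional `χ(V) = ∫ (F e^{βA + βS_M/2})(splice_{P ∪ C}(V, W)) dW` has zero `L²`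
norm — the tree's odd mechanism (`WilsonOddRP.oIntegrand_translateLow`, translation of the crossing
links, Gram expansion of the crossing Boltzmann factor) run with the vanishing lemma `GramZero`
(every Gram word vanishes, in particular the empty one) and the tree's core identity with a shared
block (`LatticeRP.integral_splice_mul_conj_comp_of_shared`).
-/

set_option autoImplicit false

noncomputable section

namespace Summit.QuantumFields.YangMills.Theorems.FemtoCurvatureTwoPoint.StrictRP

open MeasureTheory Finset
open scoped Matrix ComplexConjugate
open Literature.MathematicalPhysics.QuantumFieldTheory

section OddTransferForm

variable {d L N : ℕ} [NeZero d] [NeZero L] [Fact (1 < L)] {G : Type*} [Group G]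
  [TopologicalSpace G] [IsTopologicalGroup G] [CompactSpace G] [MeasurableSpace G] [BorelSpace G]
  (ρ : G →* Matrix (Fin N) (Fin N) ℂ)

/-- **Transfer form of the crossing-free slab functional (odd torus).** For a spatial plaquette `q`
in the middle slice `t = L/2`:
`χ_ℝ(V) = ∫ (Re tr ρ(W_q) − m) · exp(β rest(splice(V, W))) · K_{E_mid}(shiftUp V, W) dW` —
resample the top temporal links, recognise the slice kernel of the middle slice with a gauge
transformation on the BOUNDARY side, flip it to the slice side (unitarity), swap the resamplings and
remove it by gauge invariance. [folklore] -/
theorem chiOddR_eq_integral_sliceKernel (hL3 : 3 ≤ L) (hρ : Continuous ρ)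
    (hunit : ∀ g, ρ g ∈ Matrix.unitaryGroup (Fin N) ℂ) {β : ℝ} (hβ : 0 ≤ β)
    {q : Plaquette d L} (hq : q.2.1.1 ≠ 0) (hqt : (q.1 0).val = L / 2) (m : ℝ) (V : GaugeConfig d L G) :
    chiOddR ρ β q m V = ∫ W, (WilsonRP.plaqRe ρ W q - m) *
        Real.exp (β * restOddAction ρ
          (LatticeRP.splice (WilsonOddRP.oPosEdges ∪ WilsonOddRP.lowerEdges) (V, W))) *
        sliceKernel ρ β midEdges (shiftUp V) W
      ∂(LatticeRP.piMeasure (ι := Edge d L) (haarProbability G)) := by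
  classical
  set μ : Measure (GaugeConfig d L G) := LatticeRP.piMeasure (ι := Edge d L) (haarProbability G)
    with hμ
  set PC : Finset (Edge d L) := WilsonOddRP.oPosEdges ∪ WilsonOddRP.lowerEdges with hPC
  set s : GaugeConfig d L G → ℝ := fun W => (WilsonRP.plaqRe ρ W q - m) *
    Real.exp (β * restOddAction ρ (LatticeRP.splice PC (V, W))) with hs
  set CB : ℝ := Real.exp (β * (N * Fintype.card (Plaquette d L))) with hCB
  have hexp_rest : ∀ U : GaugeConfig d L G, |Real.exp (β * restOddAction ρ U)| ≤ CB := fun U => by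
    rw [abs_of_pos (Real.exp_pos _)]
    refine Real.exp_le_exp.2 (mul_le_mul_of_nonneg_left ?_ hβ)
    exact (le_abs_self _).trans (abs_sum_plaqRe_le ρ hρ _ U)
  have hexp_top : ∀ U : GaugeConfig d L G, |Real.exp (β * topAction ρ U)| ≤ CB := fun U => by
    rw [abs_of_pos (Real.exp_pos _)]
    refine Real.exp_le_exp.2 (mul_le_mul_of_nonneg_left ?_ hβ)
    exact (le_abs_self _).trans (abs_sum_plaqRe_le ρ hρ _ U)
  have hsm : Measurable s := ((WilsonRP.measurable_plaqRe ρ hρ q).sub_const m).mul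
    (((measurable_sum_plaqRe ρ hρ _).comp ((LatticeRP.measurable_splice PC).comp
      (measurable_const.prodMk measurable_id))).const_mul β).exp
  have hsb : ∀ W, |s W| ≤ (N + |m|) * CB := fun W => by
    rw [hs, abs_mul]
    exact mul_le_mul ((abs_sub _ _).trans (add_le_add (WilsonRP.abs_plaqRe_le ρ hρ W q) le_rfl))
      (hexp_rest _) (abs_nonneg _) (by positivity)
  -- step 1: split the positive action
  have step1 : chiOddR ρ β q m V = ∫ W, s W *
      Real.exp (β * topAction ρ (LatticeRP.splice PC (V, W))) ∂μ := by
    unfold chiOddR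
    refine integral_congr_ae (ae_of_all _ fun W => ?_)
    dsimp only
    rw [plaqRe_splice_odd_of_spatial ρ hq hqt, oPosAction_eq_add, mul_add, Real.exp_add]
    ring
  -- step 2: resample the top temporal links
  have hΦm : Measurable fun W => s W * Real.exp (β * topAction ρ (LatticeRP.splice PC (V, W))) :=
    hsm.mul (((measurable_sum_plaqRe ρ hρ _).comp ((LatticeRP.measurable_splice PC).comp
      (measurable_const.prodMk measurable_id))).const_mul β).exp
  have hΦb : ∀ W, |s W * Real.exp (β * topAction ρ (LatticeRP.splice PC (V, W)))| ≤
      (N + |m|) * CB * CB := fun W => by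
    rw [abs_mul]
    exact mul_le_mul (hsb W) (hexp_top _) (abs_nonneg _) (by positivity)
  have step2 := integral_eq_integral_integral_splice (topEdges : Finset (Edge d L)) hΦm hΦb
  -- step 3: the resampled integrand, pointwise
  have hs_splice : ∀ W Y, s (LatticeRP.splice topEdges (W, Y)) = s W := by
    intro W Y
    have hagree : ∀ e : Edge d L, e ∉ (topEdges : Finset (Edge d L)) →
        LatticeRP.splice topEdges (W, Y) e = W e := fun e he => by
      simp only [LatticeRP.splice_apply, if_neg he]
    have hj : q.2.1.2 ≠ 0 := WilsonRP.plaq_snd_ne_zero q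
    simp only [hs]
    congr 1
    · unfold WilsonRP.plaqRe plaquetteHolonomy
      rw [hagree _ (fun h => hq (mem_topEdges.1 h).1), hagree _ (fun h => hj (mem_topEdges.1 h).1),
        hagree _ (fun h => hq (mem_topEdges.1 h).1), hagree _ (fun h => hj (mem_topEdges.1 h).1)]
    · congr 2
      refine restOddAction_congr ρ fun e he => ?_
      simp only [LatticeRP.splice_apply]
      split_ifs with h1 h2
      · exact absurd h2 (not_mem_topEdges_of_isRestEdge he)
      · rfl
      · rfl
  have hpt : ∀ W Y, s (LatticeRP.splice topEdges (W, Y)) *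
      Real.exp (β * topAction ρ (LatticeRP.splice PC (V, LatticeRP.splice topEdges (W, Y)))) =
      s W * sliceKernel ρ β midEdges (shiftUp V)
        (gaugeTransform (fun x => (gaugeOfTop Y x)⁻¹) W) := by
    intro W Y
    rw [hs_splice]
    congr 1
    rw [← sliceKernel_gaugeTransform_left ρ hunit]
    exact exp_topAction_topSplice ρ hL3 hunit β V W Y
  -- step 4: swap the two resamplings
  have hswap : ∫ W, ∫ Y, s (LatticeRP.splice topEdges (W, Y)) *
      Real.exp (β * topAction ρ (LatticeRP.splice PC (V, LatticeRP.splice topEdges (W, Y)))) ∂μ ∂μ =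
      ∫ Y, ∫ W, s (LatticeRP.splice topEdges (W, Y)) *
      Real.exp (β * topAction ρ (LatticeRP.splice PC (V, LatticeRP.splice topEdges (W, Y)))) ∂μ ∂μ := by
    refine integral_integral_swap ?_
    refine Integrable.of_bound ((hΦm.comp (LatticeRP.measurable_splice topEdges)).aestronglyMeasurable)
      ((N + |m|) * CB * CB) (ae_of_all _ fun p => ?_)
    rw [Real.norm_eq_abs]
    exact hΦb _
  -- step 5: remove the gauge transformation for each `Y`
  have hinner : ∀ Y, ∫ W, s W * sliceKernel ρ β midEdges (shiftUp V)
      (gaugeTransform (fun x => (gaugeOfTop Y x)⁻¹) W) ∂μ =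
      ∫ W, s W * sliceKernel ρ β midEdges (shiftUp V) W ∂μ := by
    intro Y
    set γ : Site d L → G := gaugeOfTop Y with hγ
    set g : Site d L → G := fun x => (γ x)⁻¹ with hg
    have hγs : ∀ x : Site d L, (x 0).val ≠ L / 2 → γ x = 1 := fun x hx => gaugeOfTop_of_ne Y hx
    have hsinv : ∀ W, s (gaugeTransform γ W) = s W := fun W => by
      simp only [hs]
      rw [plaqRe_gaugeTransform, splice_gaugeTransform_odd hγs, restOddAction_gaugeTransform]
    have hφm : Measurable fun W => s (gaugeTransform γ W) * sliceKernel ρ β midEdges (shiftUp V) W :=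
      (hsm.comp (WilsonGauge.measurePreserving_gaugeTransform γ).measurable).mul
        (measurable_sliceKernel ρ hρ β _ _)
    have hcv := integral_comp_eq_of_measurePreserving_real
      (WilsonGauge.measurePreserving_gaugeTransform (d := d) (L := L) (G := G) g) hφm
    have hgg : ∀ W : GaugeConfig d L G, gaugeTransform γ (gaugeTransform g W) = W := fun W => by
      have h := gaugeTransform_inv_gaugeTransform g W
      simp only [hg, inv_inv] at h
      exact h
    simp only [hgg] at hcv
    rw [hcv]
    exact integral_congr_ae (ae_of_all _ fun W => by dsimp only; rw [hsinv])
  rw [step1, step2, hswap]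
  simp_rw [hpt, hinner]
  rw [integral_const, probReal_univ, one_smul]

end OddTransferForm

section OddRP

variable {d L N : ℕ} [NeZero d] [NeZero L] [Fact (1 < L)] {G : Type*} [Group G]
  [TopologicalSpace G] [IsTopologicalGroup G] [CompactSpace G] [MeasurableSpace G] [BorelSpace G]
  (ρ : G →* Matrix (Fin N) (Fin N) ℂ)

/-- **The crossing-free reflection form of the odd torus, with equality**: if the full reflection
form of the Wilson weight vanishes, the crossing-free slab functional
`χ(V) = ∫ (F e^{βA + βS_M/2})(splice_{P ∪ C}(V, W)) dW` has zero `L²` norm (the tree's odd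
mechanism `WilsonOddRP.integral_oddCov_nonneg` run with `GramZero`). [folklore] -/
theorem integral_oddChi_normSq_eq_zero (hL : Odd L) (hρ : Continuous ρ) {β : ℝ}
    (hβ : 0 ≤ β) {F : GaugeConfig d L G → ℂ} (hF : Measurable F) {CF : ℝ} (hFb : ∀ U, ‖F U‖ ≤ CF)
    (hFdep : DependsOn F ((WilsonOddRP.oPosEdges ∪ WilsonOddRP.oSharedEdges : Finset (Edge d L)) :
      Set (Edge d L)))
    (h0 : ∫ U, (Real.exp (-β * wilsonAction ρ U) : ℂ) * (conj (F (GaugeConfig.timeReflect U)) * F U)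
      ∂(LatticeRP.piMeasure (ι := Edge d L) (haarProbability G)) = 0) :
    ∫ V, (∫ W, WilsonOddRP.oObs ρ β F
            (LatticeRP.splice (WilsonOddRP.oPosEdges ∪ WilsonOddRP.lowerEdges) (V, W))
            ∂(LatticeRP.piMeasure (ι := Edge d L) (haarProbability G))) *
        conj (∫ W, WilsonOddRP.oObs ρ β F
            (LatticeRP.splice (WilsonOddRP.oPosEdges ∪ WilsonOddRP.lowerEdges) (V, W))
            ∂(LatticeRP.piMeasure (ι := Edge d L) (haarProbability G)))
      ∂(LatticeRP.piMeasure (ι := Edge d L) (haarProbability G)) = 0 := by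
  set μ : Measure (GaugeConfig d L G) := LatticeRP.piMeasure (haarProbability G) with hμ
  -- the covariant form of the observable `conj F(ΘU) F(U)` (as in the tree's plain odd RP)
  have hFdep' : DependsOn F ((WilsonOddRP.oPosEdges ∪ WilsonOddRP.lowerEdges ∪
      WilsonOddRP.oSharedEdges : Finset (Edge d L)) : Set (Edge d L)) := fun U V hUV =>
    hFdep fun e he => hUV e (by
      rw [Finset.coe_union] at he
      rcases he with he | he
      · simp [WilsonOddRP.mem_oPosEdges.1 he]
      · simp [WilsonOddRP.mem_oSharedEdges.1 he])
  have hPM : ∀ e : Edge d L, e ∈ ((WilsonOddRP.oPosEdges ∪ WilsonOddRP.oSharedEdges :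
      Finset (Edge d L)) : Set (Edge d L)) → ¬ WilsonRP.IsLowerCross e := fun e he hc => by
    rw [Finset.coe_union] at he
    rcases he with he | he
    · exact WilsonOddRP.not_isOPosEdge_of_isLowerCross hc (WilsonOddRP.mem_oPosEdges.1 he)
    · exact WilsonOddRP.not_isOSharedEdge_of_isLowerCross hc (WilsonOddRP.mem_oSharedEdges.1 he)
  have hcov : ∀ U Y : GaugeConfig d L G, conj (F (WilsonOddRP.translateLow Y U).timeReflect) *
      F (WilsonOddRP.translateLow Y U) =
      ∑ _k : Unit, F (LatticeRP.splice WilsonOddRP.lowerEdges (U, Y)) * conj (F U.timeReflect) := by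
    intro U Y
    rw [Fintype.sum_unique, mul_comm]
    congr 1
    · exact hFdep fun e he => WilsonOddRP.translateLow_apply_of_not_isLowerCross Y U (hPM e he)
        |>.trans (WilsonOddRP.splice_apply_of_not_isLowerCross U Y (hPM e he)).symm
    · congr 1
      refine hFdep fun e he => ?_
      have hne : ¬ WilsonRP.IsLowerCross (WilsonRP.edgeReflect e) := by
        intro hc
        have := WilsonOddRP.edgeReflect_of_isLowerCross (d := d) (L := L) hc
        rw [WilsonRP.edgeReflect_edgeReflect] at this
        rw [this] at he
        exact hPM _ he hc
      rw [WilsonRP.timeReflect_apply, WilsonRP.timeReflect_apply,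
        WilsonOddRP.translateLow_apply_of_not_isLowerCross Y U hne]
  -- the tree's substitution: `∫ H = ∫∫ oIntegrand₂`
  set H : GaugeConfig d L G → ℂ := fun U =>
    (Real.exp (-β * wilsonAction ρ U) : ℂ) * (conj (F U.timeReflect) * F U) with hH
  have hΦm : Measurable fun U : GaugeConfig d L G => conj (F U.timeReflect) * F U :=
    (Complex.continuous_conj.measurable.comp (hF.comp WilsonRP.measurable_timeReflect)).mul hF
  have hHm : Measurable H :=
    (Complex.measurable_ofReal.comp ((WilsonRP.measurable_wilsonAction ρ hρ).const_mul (-β)).exp).mul hΦm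
  have hR : ∀ U Y, H (WilsonOddRP.translateLow Y U) =
      ∑ _k : Unit, WilsonOddRP.oIntegrand₂ ρ hρ β F (U, Y) := fun U Y => by
    have h := WilsonOddRP.oIntegrand_translateLow ρ hL hρ hβ
      (Φ := fun U => conj (F U.timeReflect) * F U) (g := fun _ : Unit => F) hcov U Y
    simpa only [hH] using h
  have hRi : Integrable (WilsonOddRP.oIntegrand₂ ρ hρ β F) (μ.prod μ) :=
    Integrable.of_bound (WilsonOddRP.measurable_oIntegrand₂ ρ hρ β hF).aestronglyMeasurable _
      (ae_of_all _ (WilsonOddRP.norm_oIntegrand₂_le ρ hρ β hFb))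
  have step1 : ∫ U, H U ∂μ = ∫ Y, ∫ U, WilsonOddRP.oIntegrand₂ ρ hρ β F (U, Y) ∂μ ∂μ := by
    have hY : ∀ Y, ∫ U, H U ∂μ = ∫ U, WilsonOddRP.oIntegrand₂ ρ hρ β F (U, Y) ∂μ := fun Y => by
      rw [← LatticeRP.integral_comp_eq_of_measurePreserving (WilsonOddRP.measurePreserving_translateLow Y) hHm]
      exact integral_congr_ae (ae_of_all _ fun U => by dsimp only; rw [hR U Y, Fintype.sum_unique])
    calc ∫ U, H U ∂μ = ∫ _Y, (∫ U, H U ∂μ) ∂μ := by rw [integral_const, probReal_univ, one_smul]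
      _ = _ := integral_congr_ae (ae_of_all _ hY)
  rw [← integral_prod_symm _ hRi] at step1
  have hHH : ∫ U, H U ∂μ = 0 := h0
  rw [hHH] at step1
  -- strip the constant and apply the Gram-zero lemma to the crossing exponential
  have hexp : ∫ p, WilsonOddRP.oObs ρ β F (LatticeRP.splice WilsonOddRP.lowerEdges p) *
      conj (WilsonOddRP.oObs ρ β F p.1.timeReflect) *
      Complex.exp (∑ i, WilsonOddRP.oCoeff ρ hρ β i (LatticeRP.splice WilsonOddRP.lowerEdges p) *
        conj (WilsonOddRP.oCoeff ρ hρ β i p.1.timeReflect)) ∂(μ.prod μ) = 0 := by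
    have h := step1.symm
    unfold WilsonOddRP.oIntegrand₂ at h
    rw [integral_const_mul] at h
    exact (mul_eq_zero.1 h).resolve_left (Complex.ofReal_ne_zero.2 (Real.exp_pos _).ne')
  have hempty := GramZero.integral_splice_mul_conj_comp_eq_zero_of_exp_eq_zero (haarProbability G)
    WilsonOddRP.oSharedEdges WilsonOddRP.oPosEdges WilsonOddRP.lowerEdges GaugeConfig.timeReflect
    WilsonRP.measurePreserving_timeReflect
    (fun U e he => WilsonOddRP.timeReflect_apply_of_mem_oSharedEdges hL U e he)
    (fun e he => WilsonOddRP.dependsOn_timeReflect_apply hL e he)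
    WilsonOddRP.disjoint_oSharedEdges_oPosEdges WilsonOddRP.disjoint_oSharedEdges_lowerEdges
    (WilsonOddRP.measurable_oObs ρ hρ β hF) (fun i => WilsonOddRP.measurable_oCoeff ρ hρ β i)
    (WilsonOddRP.norm_oObs_le ρ hρ β hFb) (fun i U => WilsonOddRP.norm_oCoeff_le ρ hρ β i U)
    (WilsonOddRP.dependsOn_oObs ρ hL β hFdep') (fun i => WilsonOddRP.dependsOn_oCoeff ρ hL hρ β i) hexp
  rw [LatticeRP.integral_splice_mul_conj_comp_of_shared (haarProbability G)
    WilsonOddRP.oSharedEdges WilsonOddRP.oPosEdges WilsonOddRP.lowerEdges GaugeConfig.timeReflect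
    WilsonRP.measurePreserving_timeReflect
    (fun U e he => WilsonOddRP.timeReflect_apply_of_mem_oSharedEdges hL U e he)
    (fun e he => WilsonOddRP.dependsOn_timeReflect_apply hL e he)
    WilsonOddRP.disjoint_oSharedEdges_oPosEdges WilsonOddRP.disjoint_oSharedEdges_lowerEdges
    (WilsonOddRP.measurable_oObs ρ hρ β hF) (WilsonOddRP.norm_oObs_le ρ hρ β hFb)
    (WilsonOddRP.dependsOn_oObs ρ hL β hFdep')] at hempty
  exact hempty

end OddRP

/-- **Registered sub-goal `stub_oddSlabTransferForm`** (`--supports stmt-QuantumFields-9363`): closed form of `chiOddR_eq_integral_sliceKernel` — the transfer form of the crossing-free slab functional. [folklore] -/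
theorem stub_oddSlabTransferForm : ∀ (d L N : ℕ) [NeZero d] [NeZero L] [Fact (1 < L)] (G : Type) [Group G] [TopologicalSpace G] [IsTopologicalGroup G] [CompactSpace G] [MeasurableSpace G] [BorelSpace G] (ρ : G →* Matrix (Fin N) (Fin N) ℂ), 3 ≤ L → Continuous ρ → (∀ g, ρ g ∈ Matrix.unitaryGroup (Fin N) ℂ) → ∀ (β : ℝ), 0 ≤ β → ∀ (q : Literature.MathematicalPhysics.QuantumFieldTheory.Plaquette d L), q.2.1.1 ≠ 0 → (q.1 0).val = L / 2 → ∀ (m : ℝ) (V : Literature.MathematicalPhysics.QuantumFieldTheory.GaugeConfig d L G), Summit.QuantumFields.YangMills.Theorems.FemtoCurvatureTwoPoint.StrictRP.chiOddR ρ β q m V = ∫ W, (Literature.MathematicalPhysics.QuantumFieldTheory.WilsonRP.plaqRe ρ W q - m) * Real.exp (β * Summit.QuantumFields.YangMills.Theorems.FemtoCurvatureTwoPoint.StrictRP.restOddAction ρ (Literature.MathematicalPhysics.QuantumFieldTheory.LatticeRP.splice (Literature.MathematicalPhysics.QuantumFieldTheory.WilsonOddRP.oPosEdges ∪ Literature.MathematicalPhysics.QuantumFieldTheory.WilsonOddRP.lowerEdges)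 (V, W))) * Summit.QuantumFields.YangMills.Theorems.FemtoCurvatureTwoPoint.StrictRP.sliceKernel ρ β Summit.QuantumFields.YangMills.Theorems.FemtoCurvatureTwoPoint.StrictRP.midEdges (Summit.QuantumFields.YangMills.Theorems.FemtoCurvatureTwoPoint.StrictRP.shiftUp V) W ∂(Literature.MathematicalPhysics.QuantumFieldTheory.LatticeRP.piMeasure (ι := Literature.MathematicalPhysics.QuantumFieldTheory.Edge d L) (Literature.MathematicalPhysics.QuantumFieldTheory.haarProbability G)) := by
  intro d L N _ _ _ G _ _ _ _ _ _ ρ hL3 hρ hunit β hβ q hq hqt m V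
  exact chiOddR_eq_integral_sliceKernel ρ hL3 hρ hunit hβ hq hqt m V

end Summit.QuantumFields.YangMills.Theorems.FemtoCurvatureTwoPoint.StrictRP

end
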